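import Summits.FinalStateConjecture.FinalStateConjecture.Theses.PhaseMixingCapture

/-!
# `WeakCosmicCensorshipMGHD` (crux `stmt-FinalStateConjecture-9952`): the hypothesis
# `[SecondCountableTopology Σ]` is redundant

Support file of the crux disprover (cdisprove seat, cycle 2), `sorry`-free, no definitions, no
named facts. A `3`-manifold carrying an asymptotically flat end which is its SOLE end
(`AFEnd.IsSoleEnd`: the complement of a far region is compact) is second countable
(`secondCountableTopology_of_isSoleEnd`: the end is a chart domain, the compact complement is
covered by finitely many chart domains, and a finite union of open second-countable subspaces is
second countable). Every admissible datum carries such an end, so on a manifold that is NOT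
second countable the admissible class is empty and every genericity statement relative to it
holds vacuously; consequently the crux implies its own strengthening with the instance
hypothesis `[SecondCountableTopology Σ]` deleted (`wccWithoutSecondCountable_of_wcc`) — the
hypothesis is not load-bearing (the converse is trivial).

## References

* R. Bartnik, CPAM 39 (1986), §1, §4 (structure of infinity; one end).
* D. Christodoulou, CQG 16 (1999) A23, p. A24 (the admissible class).
-/

noncomputable section

open Bundle TopologicalSpace Manifold Set Function Filter
open scoped ContDiff Topology

namespace Summit.FinalStateConjecture.FinalStateConjecture.Theorems.WeakCosmicCensorshipMGHD.Negative

open Literature.Geometry.Lorentzian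
open Summit.FinalStateConjecture.FinalStateConjecture.Theses.PhaseMixingCapture (WeakCosmicCensorshipMGHD)

section SoleEnd

variable {X : Type*} [TopologicalSpace X] [ChartedSpace E3 X]

/-- The domain of an asymptotically flat end is second countable (it is diffeomorphic to an
exterior region of `ℝ³`). [cite: Bartnik1986, §1] -/
theorem secondCountableTopology_U (e : AFEnd X) : SecondCountableTopology e.U :=
  e.chart.toHomeomorph.secondCountableTopology

/-- Chart domains are second countable (homeomorphic to open subsets of `ℝ³`). [folklore] -/
theorem secondCountableTopology_chart_source (x : X) :
    SecondCountableTopology (chartAt E3 x).source :=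
  (chartAt E3 x).toHomeomorphSourceTarget.secondCountableTopology

/-- **A `3`-manifold with a sole asymptotically flat end is second countable**: `X` is the union
of the end (a chart domain) and a compact set, which finitely many chart domains cover.
[cite: Bartnik1986, §4] -/
theorem secondCountableTopology_of_isSoleEnd (e : AFEnd X) (he : e.IsSoleEnd) :
    SecondCountableTopology X := by
  classical
  obtain ⟨R', -, hK⟩ := he
  -- finitely many chart domains cover the compact complement of the far region
  obtain ⟨t, ht⟩ := hK.elim_finite_subcover (fun x : X ↦ (chartAt E3 x).source)
    (fun x ↦ (chartAt E3 x).open_source) (fun x _ ↦ mem_iUnion.2 ⟨x, mem_chart_source E3 x⟩)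
  let U : Option t → Set X := fun i ↦ i.elim (e.U : Set X) fun x ↦ (chartAt E3 (x : X)).source
  have hUo : ∀ i, IsOpen (U i) := by
    rintro (_ | x)
    · exact e.U.2
    · exact (chartAt E3 (x : X)).open_source
  haveI : ∀ i, SecondCountableTopology (U i) := by
    rintro (_ | x)
    · exact secondCountableTopology_U e
    · exact secondCountableTopology_chart_source (x : X)
  refine secondCountableTopology_of_countable_cover hUo (eq_univ_of_forall fun y ↦ ?_)
  by_cases hy : y ∈ e.far R'
  · exact mem_iUnion.2 ⟨none, e.far_subset R' hy⟩
  · obtain ⟨x, hx⟩ := mem_iUnion.1 (ht hy)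
    obtain ⟨hxt, hyx⟩ := mem_iUnion.1 hx
    exact mem_iUnion.2 ⟨some ⟨x, hxt⟩, hyx⟩

end SoleEnd

section Crux

variable {X : Type} [TopologicalSpace X] [ChartedSpace E3 X] [IsManifold (𝓡 3) ∞ X]

/-- An admissible datum forces the data manifold to be second countable (it has a sole
asymptotically flat end). [cite: Christodoulou1999, p. A24] -/
theorem secondCountableTopology_of_mem_admissibleVacuumData {D : InitialDataSet (𝓡 3) X}
    (hD : D ∈ admissibleVacuumData X) : SecondCountableTopology X := by
  obtain ⟨-, e, -, he, -⟩ := hD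
  exact secondCountableTopology_of_isSoleEnd e he

end Crux

/-- **`[SecondCountableTopology Σ]` is redundant in the crux**: `WeakCosmicCensorshipMGHD`
implies the same statement for ALL connected Hausdorff smooth `3`-manifolds, second countable or
not — on a manifold carrying an admissible datum the instance is recovered from the datum's sole
end (`secondCountableTopology_of_mem_admissibleVacuumData`), and on the others the admissible class
is empty. (The converse implication is trivial.) [cite: Christodoulou1999, p. A24] -/
theorem wccWithoutSecondCountable_of_wcc (h : WeakCosmicCensorshipMGHD) (X : Type)
    [TopologicalSpace X] [ChartedSpace E3 X] [IsManifold (𝓡 3) ∞ X] [T2Space X]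
    [ConnectedSpace X] :
    InitialDataSet.IsChristodoulouGeneric (admissibleVacuumData X)
      (fun D ↦ (∃ 𝒟 : VacuumCauchyDevelopment D, 𝒟.IsMaximal) ∧
        ∀ 𝒟 : VacuumCauchyDevelopment D, 𝒟.IsMaximal →
          _root_.Summit.FinalStateConjecture.HasCompleteNullInfinity 𝒟.toCauchyDevelopment) 1 := by
  intro d hd
  haveI := secondCountableTopology_of_mem_admissibleVacuumData hd.1
  exact h X d hd

end Summit.FinalStateConjecture.FinalStateConjecture.Theorems.WeakCosmicCensorshipMGHD.Negative

end
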